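import Literature.NumberTheory.EllipticCurves.StableCyclicSubgroupTransportProofs
import Literature.NumberTheory.EllipticCurves.SzpiroLocalDataProofs
import Literature.NumberTheory.EllipticCurves.DegreeConjectureAbcPrelims
import Literature.NumberTheory.EllipticCurves.OrdinaryPrimesProofs
import HarnessLib

/-!
# The Frobenius-certificate criterion against a rational isogeny of prime degree, read off from
# an explicit integer model

Topic `Literature/NumberTheory/EllipticCurves`; theorems only (no definition, no named fact).
This file turns the tree's qualitative theorem
`exists_root_of_isogeny_prime_degree_of_j_eq` (`StableCyclicSubgroupTransportProofs`: a
`ℚ`-isogeny of prime degree `q` out of ANY elliptic curve with `j = j(E) ≠ 0, 1728`, `E` globally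
minimal with good reduction at the prime `ℓ ≠ q`, forces a root of `X² − a_ℓ(E)X + ℓ` in `𝔽_q`;
Mazur 1978, Prop. 6.3 (1)) into a criterion whose hypotheses are DECIDABLE INTEGER DATA of one
Weierstrass equation `E₀ = [a₁, a₂, a₃, a₄, a₆]` over `ℤ` — exactly the data recorded, level by
level, in the kernel-decided certificate files `RationalIsogenyFrobeniusCertificates*.lean`
(point counts `#Ẽ₀(𝔽_ℓ)` and root-freeness of `X² − a_ℓX + ℓ (mod q)`) for Kenku's composite
levels (Kenku 1982, proof of Thm. 1, case (c)):

* `isElliptic_baseChange_int`, `isGloballyMinimal_baseChange_int` — `E₀ ⊗ ℚ` is an elliptic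
  curve if `Δ(E₀) ≠ 0`, and a GLOBAL MINIMAL equation as soon as every prime `p` has
  `p¹² ∤ Δ(E₀)` or `p ∤ c₄(E₀)` (Silverman, *AEC* VII.1 Remark 1.1 at every place; the tree's
  `isMinimalAt_baseChange_int_of_not_pow_dvd_Δ / _of_not_dvd_c₄` and
  `isGloballyMinimal_of_forall_isMinimalAt_int`);
* `integralModelInt_baseChange_int`, `minimalDiscriminantInt_baseChange_int`,
  `reductionPointCount_baseChange_int`, `frobeniusTrace_baseChange_int` — for such a model the
  tree's invariants of the global minimal model (`GlobalMinimalModel.lean`) are computed on `E₀`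
  itself: `Δ_min = Δ(E₀)`, `N_ℓ = #(E₀ mod ℓ)(𝔽_ℓ)`, `a_ℓ = ℓ + 1 − N_ℓ`;
* `hasGoodReductionAtPrime_baseChange_int` — good reduction at every prime `ℓ ∤ Δ(E₀)`
  (Silverman VII.5.1 (a); the tree's `hasGoodReductionAtPrime_of_not_dvd`);
* `j_baseChange_int`, `j_baseChange_int_ne_zero`, `j_baseChange_int_ne_1728` —
  `j = c₄³/Δ`, nonzero iff `c₄ ≠ 0`, `≠ 1728` if `c₆ ≠ 0` (`1728Δ = c₄³ − c₆²`);
* `j_ne_of_isogeny_prime_degree_of_certificate` — **the criterion**: given such `E₀`, a prime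
  `ℓ ∤ Δ(E₀)` with `#(E₀ mod ℓ)(𝔽_ℓ) = n`, and a prime `q ≠ ℓ` such that
  `X² − (ℓ + 1 − n)X + ℓ` has no root in `ℤ/q`, NO elliptic curve over `ℚ` with
  `j = c₄(E₀)³/Δ(E₀)` admits a `ℚ`-isogeny of degree `q`;
* `forall_not_pow_dvd_or_of_bound`, `j_ne_of_isogeny_prime_degree_of_certificate'` — the same
  with the minimality hypothesis as a FINITE check (`|Δ| < B¹²` and the primes `p < B`), so that
  every hypothesis but the two certificates is closed by `decide`.

With it, one line per tabulated `j` closes a level `qN` of Kenku's case (c) from the `j`-table of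
`N` (schema `hT` of `KenkuMinimalLevels*.lean`) and the two certificate lemmas `card_…`, `noroot_…`.

## References

* [Mazur1978] B. Mazur, *Rational isogenies of prime degree*, Invent. Math. 44 (1978) 129–162:
  §5 p. 148 (isogeny character), §6 Prop. 6.3 (1) (p. 153).
* [Kenku1982] M. A. Kenku, J. Number Theory 15 (1982) 199–202, proof of Thm. 1, case (c).
* [SilvermanAEC2009] J. H. Silverman, *The Arithmetic of Elliptic Curves*, 2nd ed.: VII.1
  Remark 1.1, VII.5 Prop. 5.1 (a), VIII.8 (global minimal equations), III.1 (`j`, `c₄`, `c₆`).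
-/

noncomputable section

open scoped Classical
open IsDedekindDomain WeierstrassCurve

namespace Literature.NumberTheory.EllipticCurves

variable (E₀ : WeierstrassCurve ℤ)

/-! ### The integer model as a global minimal equation over `ℚ` -/

/-- `E₀ ⊗ ℚ` is `E₀` pushed along `ℤ → ℚ` (bookkeeping between `baseChange` and `map`).
[folklore] -/
theorem baseChange_int_eq_map : E₀.baseChange ℚ = E₀.map (Int.castRingHom ℚ) := by
  rw [baseChange, algebraMap_int_eq]

/-- `E₀ ⊗ ℚ` is an elliptic curve as soon as `Δ(E₀) ≠ 0` (Silverman, *AEC* III.1). [folklore] -/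
theorem isElliptic_baseChange_int (hΔ : E₀.Δ ≠ 0) : (E₀.baseChange ℚ).IsElliptic := by
  rw [isElliptic_iff, baseChange_int_Δ, isUnit_iff_ne_zero]
  exact_mod_cast hΔ

/-- **An integer equation with `p¹² ∤ Δ` or `p ∤ c₄` at every prime `p` is a global minimal
equation** (Silverman, *AEC* VII.1 Remark 1.1 at every place — the tree's
`isMinimalAt_baseChange_int_of_not_pow_dvd_Δ`, `isMinimalAt_baseChange_int_of_not_dvd_c₄` — and
VIII.8: minimal at every prime is globally minimal, `isGloballyMinimal_of_forall_isMinimalAt_int`).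
[cite: SilvermanAEC2009, VII.1 Remark 1.1] -/
theorem isGloballyMinimal_baseChange_int
    (hmin : ∀ p : ℕ, p.Prime → ¬ ((p : ℤ) ^ 12 ∣ E₀.Δ) ∨ ¬ ((p : ℤ) ∣ E₀.c₄)) :
    (E₀.baseChange ℚ).IsGloballyMinimal := by
  refine isGloballyMinimal_of_forall_isMinimalAt_int _ fun v ↦ ?_
  rcases hmin _ (Rat.HeightOneSpectrum.prime_natGenerator v) with h | h
  · exact isMinimalAt_baseChange_int_of_not_pow_dvd_Δ h
  · exact isMinimalAt_baseChange_int_of_not_dvd_c₄ h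

/-- **The minimality hypothesis is a finite check.** If `|Δ(E₀)| < B¹²` and every prime `p < B`
has `p¹² ∤ Δ(E₀)` or `p ∤ c₄(E₀)` (a `decide`-able statement about natural numbers), then every
prime `p` has `p¹² ∤ Δ(E₀)` or `p ∤ c₄(E₀)`: for `p ≥ B`, `p¹² > |Δ|`. [folklore] -/
theorem forall_not_pow_dvd_or_of_bound {B : ℕ} (hB : E₀.Δ.natAbs < B ^ 12) (hΔ : E₀.Δ ≠ 0)
    (hdec : ∀ p ∈ Finset.range B, p.Prime →
      ¬ (p ^ 12 ∣ E₀.Δ.natAbs) ∨ ¬ (p ∣ E₀.c₄.natAbs)) :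
    ∀ p : ℕ, p.Prime → ¬ ((p : ℤ) ^ 12 ∣ E₀.Δ) ∨ ¬ ((p : ℤ) ∣ E₀.c₄) := by
  intro p hp
  have e12 : ((p : ℤ) ^ 12 ∣ E₀.Δ) ↔ p ^ 12 ∣ E₀.Δ.natAbs := by
    rw [← Int.natCast_dvd, Nat.cast_pow]
  have e1 : ((p : ℤ) ∣ E₀.c₄) ↔ p ∣ E₀.c₄.natAbs := Int.natCast_dvd
  rw [e12, e1]
  by_cases hpB : p < B
  · exact hdec p (Finset.mem_range.mpr hpB) hp
  · left
    intro h
    have hpos : 0 < E₀.Δ.natAbs := Int.natAbs_pos.mpr hΔ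
    have hle : p ^ 12 ≤ E₀.Δ.natAbs := Nat.le_of_dvd hpos h
    have hBp : B ^ 12 ≤ p ^ 12 := Nat.pow_le_pow_left (not_lt.mp hpB) 12
    omega

/-- For a globally minimal `E₀ ⊗ ℚ` the tree's integral model over `ℤ` IS `E₀` (uniqueness of
lifts along the injection `ℤ → ℚ`; Silverman, *AEC* VIII.8). [folklore] -/
theorem integralModelInt_baseChange_int [(E₀.baseChange ℚ).IsGloballyMinimal] :
    integralModelInt (E₀.baseChange ℚ) = E₀ := by
  apply WeierstrassCurve.map_injective (f := Int.castRingHom ℚ) Int.cast_injective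
  simp only [map_integralModelInt]
  exact baseChange_int_eq_map E₀

/-- Hence its minimal discriminant is `Δ(E₀)`. [folklore] -/
theorem minimalDiscriminantInt_baseChange_int [(E₀.baseChange ℚ).IsGloballyMinimal] :
    minimalDiscriminantInt (E₀.baseChange ℚ) = E₀.Δ := by
  rw [minimalDiscriminantInt, integralModelInt_baseChange_int]

/-- Hence its point count modulo `ℓ` (the tree's `reductionPointCount`, `N_ℓ`) is the number of
points of `E₀ mod ℓ` — the quantity kernel-decided by the `card_…` certificate lemmas of
`RationalIsogenyFrobeniusCertificates*.lean`. [folklore] -/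
theorem reductionPointCount_baseChange_int [(E₀.baseChange ℚ).IsGloballyMinimal] (ℓ : ℕ) :
    reductionPointCount (E₀.baseChange ℚ) ℓ =
      Nat.card ((E₀.map (Int.castRingHom (ZMod ℓ))).toAffine.Point) := by
  rw [reductionPointCount, integralModelInt_baseChange_int]

/-- Hence its trace of Frobenius at `ℓ` (the tree's `frobeniusTrace`) is `a_ℓ = ℓ + 1 − n` when
`#(E₀ mod ℓ)(𝔽_ℓ) = n` (Silverman, *AEC* V.2). [folklore] -/
theorem frobeniusTrace_baseChange_int [(E₀.baseChange ℚ).IsGloballyMinimal] {ℓ n : ℕ}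
    (hcard : Nat.card ((E₀.map (Int.castRingHom (ZMod ℓ))).toAffine.Point) = n) :
    frobeniusTrace (E₀.baseChange ℚ) ℓ = (ℓ : ℤ) + 1 - n := by
  rw [frobeniusTrace, reductionPointCount_baseChange_int, hcard]

/-- **Good reduction at every prime `ℓ ∤ Δ(E₀)`** for a globally minimal integer equation
(Silverman, *AEC* VII.5 Prop. 5.1 (a); the tree's `hasGoodReductionAtPrime_of_not_dvd` on the
minimal discriminant `Δ_min = Δ(E₀)`). [cite: SilvermanAEC2009, VII.5 Prop. 5.1(a)] -/
theorem hasGoodReductionAtPrime_baseChange_int [(E₀.baseChange ℚ).IsGloballyMinimal] (ℓ : ℕ)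
    [Fact ℓ.Prime] (hℓ : ¬ ((ℓ : ℤ) ∣ E₀.Δ)) : (E₀.baseChange ℚ).HasGoodReductionAtPrime ℓ :=
  hasGoodReductionAtPrime_of_not_dvd _ ℓ (by rwa [minimalDiscriminantInt_baseChange_int])

/-! ### The `j`-invariant of the integer model -/

/-- `j(E₀ ⊗ ℚ) = c₄(E₀)³ / Δ(E₀)` (Silverman, *AEC* III.1). [folklore] -/
theorem j_baseChange_int [(E₀.baseChange ℚ).IsElliptic] :
    (E₀.baseChange ℚ).j = (E₀.c₄ : ℚ) ^ 3 / (E₀.Δ : ℚ) := by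
  rw [WeierstrassCurve.j, Units.val_inv_eq_inv_val, coe_Δ', div_eq_inv_mul, baseChange_int_Δ,
    baseChange_int_c₄]

/-- `j(E₀ ⊗ ℚ) ≠ 0` when `c₄(E₀) ≠ 0` (and `Δ(E₀) ≠ 0`). [folklore] -/
theorem j_baseChange_int_ne_zero [(E₀.baseChange ℚ).IsElliptic] (hc₄ : E₀.c₄ ≠ 0) :
    (E₀.baseChange ℚ).j ≠ 0 := by
  have hΔ : (E₀.Δ : ℚ) ≠ 0 := by
    have h := (E₀.baseChange ℚ).isUnit_Δ.ne_zero
    rwa [baseChange_int_Δ] at h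
  rw [j_baseChange_int]
  exact div_ne_zero (pow_ne_zero _ (by exact_mod_cast hc₄)) hΔ

/-- `j(E₀ ⊗ ℚ) ≠ 1728` when `c₆(E₀) ≠ 0`: `j − 1728 = c₆²/Δ` by `1728Δ = c₄³ − c₆²`
(Silverman, *AEC* III.1). [folklore] -/
theorem j_baseChange_int_ne_1728 [(E₀.baseChange ℚ).IsElliptic] (hc₆ : E₀.c₆ ≠ 0) :
    (E₀.baseChange ℚ).j ≠ 1728 := by
  have hΔ : (E₀.Δ : ℚ) ≠ 0 := by
    have h := (E₀.baseChange ℚ).isUnit_Δ.ne_zero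
    rwa [baseChange_int_Δ] at h
  rw [j_baseChange_int, Ne, div_eq_iff hΔ]
  intro h
  have hrel := E₀.c_relation
  have h' : (E₀.c₄ : ℚ) ^ 3 = 1728 * E₀.Δ := h
  have h'' : E₀.c₄ ^ 3 = 1728 * E₀.Δ := by exact_mod_cast h'
  have hc : E₀.c₆ ^ 2 = 0 := by linear_combination hrel + h''
  exact hc₆ (pow_eq_zero_iff (n := 2) two_ne_zero |>.mp hc)

/-! ### The criterion -/

/-- **The Frobenius-certificate criterion against a rational isogeny of prime degree.** Let
`E₀ = [a₁, a₂, a₃, a₄, a₆]` be an integer Weierstrass equation with `p¹² ∤ Δ(E₀)` or `p ∤ c₄(E₀)`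
at every prime `p` (a global minimal equation), `c₄(E₀) ≠ 0`, `c₆(E₀) ≠ 0` (`j ≠ 0, 1728`), let
`ℓ ∤ Δ(E₀)` be a prime (good reduction) with `#(E₀ mod ℓ)(𝔽_ℓ) = n`, and let `q ≠ ℓ` be a prime
such that `X² − (ℓ + 1 − n)X + ℓ` has no root in `ℤ/q`. Then no elliptic curve `W` over `ℚ` with
`j(W) = c₄(E₀)³/Δ(E₀)` has a `ℚ`-isogeny of degree `q`: by the tree's
`exists_root_of_isogeny_prime_degree_of_j_eq` (the kernel line, transported to `E₀ ⊗ ℚ` along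
`j(W) = j(E₀ ⊗ ℚ)`, gives an isogeny character `r` with `r(φ_ℓ)² − a_ℓ r(φ_ℓ) + ℓ = 0` in `𝔽_q`,
Mazur 1978, Prop. 6.3 (1)), and `a_ℓ = ℓ + 1 − n` (`frobeniusTrace_baseChange_int`). This is the
per-`j` closing step of Kenku's case (c) levels `qN` from the `j`-table of `N` and the certificate
lemmas `card_…` / `noroot_…` of `RationalIsogenyFrobeniusCertificates*.lean`.
[cite: Mazur1978, §6 Prop. 6.3 (1) (p. 153)] [cite: Kenku1982, proof of Thm. 1, case (c), p. 201] -/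
theorem j_ne_of_isogeny_prime_degree_of_certificate
    (hmin : ∀ p : ℕ, p.Prime → ¬ ((p : ℤ) ^ 12 ∣ E₀.Δ) ∨ ¬ ((p : ℤ) ∣ E₀.c₄))
    (hc₄ : E₀.c₄ ≠ 0) (hc₆ : E₀.c₆ ≠ 0)
    {ℓ : ℕ} [Fact ℓ.Prime] (hℓΔ : ¬ ((ℓ : ℤ) ∣ E₀.Δ)) {n : ℕ}
    (hcard : Nat.card ((E₀.map (Int.castRingHom (ZMod ℓ))).toAffine.Point) = n)
    {q : ℕ} [Fact q.Prime] (hℓq : ℓ ≠ q)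
    (hnoroot : ∀ t : ZMod q, t ^ 2 - (((ℓ : ℤ) + 1 - n : ℤ) : ZMod q) * t + (ℓ : ZMod q) ≠ 0)
    {W W' : WeierstrassCurve ℚ} [W.IsElliptic] [W'.IsElliptic] (ψ : Isogeny W W')
    (hq : ψ.degree = q) : W.j ≠ (E₀.c₄ : ℚ) ^ 3 / (E₀.Δ : ℚ) := by
  intro hj
  have hΔ : E₀.Δ ≠ 0 := fun h ↦ hℓΔ (h ▸ dvd_zero _)
  haveI : (E₀.baseChange ℚ).IsElliptic := isElliptic_baseChange_int E₀ hΔ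
  haveI : (E₀.baseChange ℚ).IsGloballyMinimal := isGloballyMinimal_baseChange_int E₀ hmin
  have hjE : W.j = (E₀.baseChange ℚ).j := by rw [j_baseChange_int]; exact hj
  obtain ⟨t, ht⟩ := exists_root_of_isogeny_prime_degree_of_j_eq ψ hq hjE
    (j_baseChange_int_ne_zero E₀ hc₄) (j_baseChange_int_ne_1728 E₀ hc₆) ℓ hℓq
    (hasGoodReductionAtPrime_baseChange_int E₀ ℓ hℓΔ)
  rw [frobeniusTrace_baseChange_int E₀ hcard] at ht
  exact hnoroot t ht

/-- **The criterion with every hypothesis a finite check** (the form consumed level by level): as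
`j_ne_of_isogeny_prime_degree_of_certificate`, with global minimality supplied by the bounded
check of `forall_not_pow_dvd_or_of_bound` (`|Δ| < B¹²` and the primes `p < B`) and `ℓ ∤ Δ` read in
`ℕ`. Every hypothesis except `hcard` (a `card_…` certificate) and `hnoroot` (a `noroot_…`
certificate) is then closed by `decide` on the five integers `[a₁, a₂, a₃, a₄, a₆]`.
[cite: Mazur1978, §6 Prop. 6.3 (1) (p. 153)] [cite: Kenku1982, proof of Thm. 1, case (c), p. 201] -/
theorem j_ne_of_isogeny_prime_degree_of_certificate' {B : ℕ} (hB : E₀.Δ.natAbs < B ^ 12)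
    (hdec : ∀ p ∈ Finset.range B, p.Prime →
      ¬ (p ^ 12 ∣ E₀.Δ.natAbs) ∨ ¬ (p ∣ E₀.c₄.natAbs))
    (hc₄ : E₀.c₄ ≠ 0) (hc₆ : E₀.c₆ ≠ 0)
    {ℓ : ℕ} [Fact ℓ.Prime] (hℓΔ : ¬ (ℓ ∣ E₀.Δ.natAbs)) {n : ℕ}
    (hcard : Nat.card ((E₀.map (Int.castRingHom (ZMod ℓ))).toAffine.Point) = n)
    {q : ℕ} [Fact q.Prime] (hℓq : ℓ ≠ q)
    (hnoroot : ∀ t : ZMod q, t ^ 2 - (((ℓ : ℤ) + 1 - n : ℤ) : ZMod q) * t + (ℓ : ZMod q) ≠ 0)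
    {W W' : WeierstrassCurve ℚ} [W.IsElliptic] [W'.IsElliptic] (ψ : Isogeny W W')
    (hq : ψ.degree = q) : W.j ≠ (E₀.c₄ : ℚ) ^ 3 / (E₀.Δ : ℚ) := by
  have hℓΔ' : ¬ ((ℓ : ℤ) ∣ E₀.Δ) := by rwa [Int.natCast_dvd]
  have hΔ : E₀.Δ ≠ 0 := fun h ↦ hℓΔ' (h ▸ dvd_zero _)
  exact j_ne_of_isogeny_prime_degree_of_certificate E₀
    (forall_not_pow_dvd_or_of_bound E₀ hB hΔ hdec) hc₄ hc₆ hℓΔ' hcard hℓq hnoroot ψ hq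

end Literature.NumberTheory.EllipticCurves

end
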